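import Literature.Analysis.FluidPDE.NSLerayHopf
import Literature.Analysis.FluidPDE.NSEnstrophyBalance2DGalerkin
import Literature.Analysis.FluidPDE.NSStokesTruncation2D
import Literature.Analysis.FluidPDE.ScalarEnergyCalculus
import Literature.Analysis.FluidPDE.NSUniqueness2DTruncatedBalance
import Literature.Analysis.FluidPDE.StokesTorus
import HarnessLib

/-!
# Navier–Stokes on `𝕋²`: the enstrophy balance of regular Leray–Hopf solutions
  (discharge of `NS.enstrophy_balance_of_regular_torus2`)

Trunk: FluidKinetic. This file proves the named sub-result
`Literature.Analysis.FluidPDE.enstrophy_balance_of_regular_torus2` of the proof architecture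
`NSEnstrophyBalance2DGalerkin` of `fmrt_enstrophy_balance_torus2` (Foias–Manley–Rosa–Temam 2001,
Ch. II Remark 7.1 and App. II.A (A.62), (A.65)): a Leray–Hopf weak solution `u` of the 2-D
space-periodic Navier–Stokes equations on `[0,T)` (steady smooth force `f`) with
`sup_{t∈(0,T]} ‖∇u(t)‖₂ < ∞` and `∫₀ᵀ ‖Δu‖₂² < ∞` satisfies, for `0 < s ≤ t ≤ T`,
`½‖∇u(t)‖₂² + ν∫ₛᵗ‖Δu‖₂² = ½‖∇u(s)‖₂² - ∫ₛᵗ∫⟪Δf, u⟫`.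

## The argument ("replace `v` by `Au` in (7.1)", FMRT Remark 7.1, made honest)

The weak formulation can only be tested against smooth divergence-free STEADY fields; the
time-sliced form (`Torus.IsLerayHopfOn.integral_inner_sub_eq_setIntegral`,
`LerayHopfTimeSliceTorus`) tested against the real Stokes eigenfields
`ψ_{k,j,c} = Re(e_k ζ_c Π_k e_j)` (`Torus.frameField`, `StatisticalSolutionEnergyEq`) gives
integral equations for the real Fourier coordinates `V_{k,j,c}(τ) = ⟨u(τ), ψ_{k,j,c}⟩` of `u`:
`V(t) - V(s) = ∫ₛᵗ (N - ν·4π²|k|² V + F)` with the trilinear `N = ∫⟪u,(u·∇)ψ⟫` and the force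
`F = ⟨f, ψ⟩` (`Torus.modeCoord_sub_eq`). Squaring (`sq_sub_sq_eq_setIntegral_of_sub_eq_setIntegral`,
`ScalarEnergyCalculus`) and summing over the frame of the punctured ball `0 < |k| ≤ N` with the
weights `4π²|k|²` gives the enstrophy identity of the truncation `P_N u`
(`Torus.truncEnstrophy_sub_eq`):
`‖∇P_N u(t)‖² - ‖∇P_N u(s)‖² = 2∫ₛᵗ (-β_N - ν·16π⁴∑_{|k|≤N}|k|⁴‖û(k)‖² + ∑_{|k|≤N} 4π²|k|² Re⟪û(k), f̂(k)⟫)`,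
where, by the frame identities (`Torus.sum_sum_re_inner_frameVec_smul`, one-frequency Parseval
`Torus.sum_sum_sq_re_inner_frameVec`) the summed trilinear term is
`β_N(τ) = ∫⟪u, (u·∇) ΔP_N u⟫` (`Torus.nonlinRate_eq`). As `N → ∞`: the left side tends to
`‖∇u(t)‖² - ‖∇u(s)‖²`, the palinstrophy sums increase to `∫‖Δu‖²`, the force sums tend to
`-∫⟪Δf,u⟫` (Parseval, `𝓕(Δf) = -4π²|k|²f̂`), and `∫ₛᵗ β_N → 0` by dominated convergence and the
slicewise estimate of `NSStokesTruncation2D` — the 2-D orthogonality (A.62) `b(v,v,Av) = 0` for the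
non-smooth `v = u(τ) ∈ D(A)` (`Torus.abs_integral_inner_convect_laplacian_fourierTruncate_le`).

## Mathlib / tree search

Reused from the tree: the time-sliced weak formulation and its integrability/measurability
(`LerayHopfTimeSliceTorus`), the frame of real Stokes eigenfields and its one-frequency Parseval /
reconstruction identities (`StatisticalSolutionEnergyEq`), `Torus.isWeaklyDivFree_of_mem_Ioc`,
`Torus.laplacian_frameField`, `Torus.isSmooth_frameField` (`NSUniqueness2DTruncatedBalance`, the
parallel truncated *energy* balance of a difference of two solutions), the scalar square calculus
(`ScalarEnergyCalculus`), `tendsto_toReal_eGradNormSq_fourierTruncate`, and the slicewise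
trilinear estimate of `NSStokesTruncation2D`. From Mathlib: dominated convergence
(`tendsto_integral_of_dominated_convergence`), `ENNReal.tendsto_toReal`, `ae_lt_top'`.

## References

* C. Foias, O. Manley, R. Rosa, R. Temam, *Navier–Stokes Equations and Turbulence*, CUP 2001,
  Ch. II Thm. 7.4, Remark 7.1 (PDF pp. 72–73); App. II.A (A.55), (A.62), (A.65) (PDF pp. 117–118).
* R. Temam, *Navier–Stokes Equations*, 3rd ed., North-Holland 1984, Ch. III §1 Lemma 1.2,
  Thm. 3.10.
* S. Kuksin, A. Shirikyan, *Mathematics of Two-Dimensional Turbulence*, CUP 2012, Prop. 2.1.21 (ii).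

*Imports (module hygiene, 2026-08-16, refactor item `defn-NSLerayHopfOpenFacts`):* the hub
`Literature.Analysis.FluidPDE.NSLerayHopf` is imported explicitly (this file uses its
declarations), since `NSHopfGalerkin` — through which it used to arrive — no longer imports it.
-/

noncomputable section

open MeasureTheory TopologicalSpace Set Function Filter Topology UnitAddTorus
open scoped InnerProductSpace RealInnerProductSpace ENNReal NNReal

namespace Literature.Analysis.FluidPDE.Torus

open FunctionSpaces FunctionSpaces.Torus

variable {d : Type*} [Fintype d] [DecidableEq d]

/-! ### The Fourier coefficients of the slices of a Leray–Hopf solution are transversal -/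

section Slice

variable {T ν : ℝ} {F : ℝ → UnitAddTorus d → EuclideanSpace ℝ d}
  {u₀ : UnitAddTorus d → EuclideanSpace ℝ d} {u : ℝ → UnitAddTorus d → EuclideanSpace ℝ d}

/-- The Fourier coefficients of every slice `u(τ)`, `τ ∈ (0, T]`, are transversal:
`∑ⱼ kⱼ û(τ)(k)ⱼ = 0`. [folklore] -/
theorem IsLerayHopfOn.sum_mul_mFourierCoeff_slice (hu : IsLerayHopfOn T ν F u₀ u) {τ : ℝ}
    (hτ : τ ∈ Ioc 0 T) (k : d → ℤ) :
    ∑ j, (k j : ℂ) * mFourierCoeff (EuclideanSpace.complexify ∘ u τ) k j = 0 :=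
  (hu.isWeaklyDivFree_of_mem_Ioc hτ).sum_mul_mFourierCoeff_eq_zero (hu.memLp τ ⟨hτ.1.le, hτ.2⟩) k

end Slice

/-! ### The real Fourier coordinates of a Leray–Hopf solution and their integral equations -/

section Modes

variable {T ν : ℝ} {f : UnitAddTorus d → EuclideanSpace ℝ d}
  {u₀ : UnitAddTorus d → EuclideanSpace ℝ d} {u : ℝ → UnitAddTorus d → EuclideanSpace ℝ d}

/-- The pairing `⟨w, ψ_{k,j,c}⟩ = ∫⟪w, ψ_{k,j,c}⟫` of a real field with a frame field. [folklore] -/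
def modePairing (k : d → ℤ) (j : d) (c : Bool) (w : UnitAddTorus d → EuclideanSpace ℝ d) : ℝ :=
  ∫ x, ⟪w x, frameField k j c x⟫

/-- **The real Fourier coordinates** `V_{k,j,c}(τ) = ⟨u(τ), ψ_{k,j,c}⟩` of a time-dependent field. [folklore] -/
def modeCoord (u : ℝ → UnitAddTorus d → EuclideanSpace ℝ d) (k : d → ℤ) (j : d) (c : Bool) (τ : ℝ) : ℝ :=
  modePairing k j c (u τ)

/-- The trilinear term against a frame field: `N_{k,j,c}(τ) = ∫⟪u(τ), (u(τ)·∇)ψ_{k,j,c}⟫`. [folklore] -/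
def modeNonlin (u : ℝ → UnitAddTorus d → EuclideanSpace ℝ d) (k : d → ℤ) (j : d) (c : Bool) (τ : ℝ) : ℝ :=
  ∫ x, ⟪u τ x, FunctionSpaces.Torus.convect (u τ) (frameField k j c) x⟫

/-- The force coefficient `F_{k,j,c} = ⟨f, ψ_{k,j,c}⟩` of a steady force. [folklore] -/
def modeForce (f : UnitAddTorus d → EuclideanSpace ℝ d) (k : d → ℤ) (j : d) (c : Bool) : ℝ :=
  ∫ x, ⟪f x, frameField k j c x⟫

/-- The flux of the time-sliced weak formulation against a frame field:
`Φ_{k,j,c}(τ) = ∫ (⟪u, (u·∇)ψ⟫ + ν⟪u, Δψ⟫ + ⟪f, ψ⟫)`, `ψ = ψ_{k,j,c}`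
(`Torus.IsLerayHopfOn.integral_inner_sub_eq_setIntegral`). [folklore] -/
def modeFlux (ν : ℝ) (f : UnitAddTorus d → EuclideanSpace ℝ d) (u : ℝ → UnitAddTorus d → EuclideanSpace ℝ d)
    (k : d → ℤ) (j : d) (c : Bool) (τ : ℝ) : ℝ :=
  ∫ x, (⟪u τ x, FunctionSpaces.Torus.convect (u τ) (frameField k j c) x⟫ +
    ν * ⟪u τ x, FunctionSpaces.Torus.laplacian (frameField k j c) x⟫ + ⟪f x, frameField k j c x⟫)

/-- The pairing in Fourier variables: `⟨w, ψ_{k,j,c}⟩ = Re⟪ŵ(k), frameVec k j c⟫`. [folklore] -/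
theorem modePairing_eq_re {w : UnitAddTorus d → EuclideanSpace ℝ d} (hw : Integrable w volume)
    (k : d → ℤ) (j : d) (c : Bool) :
    modePairing k j c w = (inner ℂ (mFourierCoeff (EuclideanSpace.complexify ∘ w) k) (frameVec k j c)).re :=
  integral_inner_realTrigPoly_singleton hw k _

/-- **The flux decomposes**: `Φ_{k,j,c}(τ) = N_{k,j,c}(τ) - ν·4π²|k|² V_{k,j,c}(τ) + F_{k,j,c}`
for `u(τ) ∈ L²` and a smooth `f` (`Δψ = -4π²|k|²ψ`). [folklore] -/
theorem modeFlux_eq {τ : ℝ} (huτ : MemLp (u τ) 2 volume) (hf : IsSmooth f) (k : d → ℤ) (j : d)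
    (c : Bool) :
    modeFlux ν f u k j c τ = modeNonlin u k j c τ - ν * stokesEigenvalue k * modeCoord u k j c τ + modeForce f k j c := by
  have hΨ := isSmooth_frameField k j c
  have i1 : Integrable (fun x => ⟪u τ x, FunctionSpaces.Torus.convect (u τ) (frameField k j c) x⟫) volume :=
    integrable_inner_convect_self huτ hΨ
  have i2 : Integrable (fun x => ν * ⟪u τ x, FunctionSpaces.Torus.laplacian (frameField k j c) x⟫) volume :=
    (integrable_inner_of_continuous (huτ.integrable one_le_two) hΨ.laplacian.continuous).const_mul ν
  have i3 : Integrable (fun x => ⟪f x, frameField k j c x⟫) volume :=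
    integrable_inner_of_continuous hf.integrable hΨ.continuous
  have hL : ∫ x, ν * ⟪u τ x, FunctionSpaces.Torus.laplacian (frameField k j c) x⟫ =
      -(ν * stokesEigenvalue k) * modeCoord u k j c τ := by
    simp_rw [laplacian_frameField, inner_smul_right]
    rw [integral_const_mul, integral_const_mul, modeCoord, modePairing, stokesEigenvalue]
    ring
  have i12 : Integrable (fun x => ⟪u τ x, FunctionSpaces.Torus.convect (u τ) (frameField k j c) x⟫ +
      ν * ⟪u τ x, FunctionSpaces.Torus.laplacian (frameField k j c) x⟫) volume := i1.add i2
  rw [modeFlux, integral_add i12 i3, integral_add i1 i2, hL, modeNonlin, modeForce]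
  ring

/-- **The integral equation of a coordinate**: for a Leray–Hopf solution with a steady smooth
force and `0 < s ≤ t ≤ T`, `k ≠ 0`,
`V_{k,j,c}(t) - V_{k,j,c}(s) = ∫_{(s,t]} Φ_{k,j,c}` (the time-sliced weak formulation tested
against the smooth divergence-free `ψ_{k,j,c}`). [folklore] -/
theorem modeCoord_sub_eq (hu : IsLerayHopfOn T ν (fun _ => f) u₀ u) (hT : 0 < T) (hf : IsSmooth f)
    {k : d → ℤ} (hk : k ≠ 0) (j : d) (c : Bool) {s t : ℝ} (hs : 0 < s) (hst : s ≤ t) (htT : t ≤ T) :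
    modeCoord u k j c t - modeCoord u k j c s = ∫ τ in Ioc s t, modeFlux ν f u k j c τ :=
  hu.integral_inner_sub_eq_setIntegral hT (aestronglyMeasurable_stLift_const hf _)
    (lintegral_enorm_sq_const_lt_top hf T) (isSmooth_frameField k j c) (isDivFree_frameField hk j c)
    hs hst htT

/-- The flux is integrable on `(0, T)`. [folklore] -/
theorem integrableOn_modeFlux (hu : IsLerayHopfOn T ν (fun _ => f) u₀ u) (hf : IsSmooth f)
    (k : d → ℤ) (j : d) (c : Bool) : IntegrableOn (modeFlux ν f u k j c) (Ioo 0 T) :=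
  hu.integrableOn_flux (aestronglyMeasurable_stLift_const hf _) (lintegral_enorm_sq_const_lt_top hf T)
    (isSmooth_frameField k j c)

/-- The flux is integrable on `(0, T]`. [folklore] -/
theorem integrableOn_modeFlux_Ioc (hu : IsLerayHopfOn T ν (fun _ => f) u₀ u) (hf : IsSmooth f)
    (k : d → ℤ) (j : d) (c : Bool) : IntegrableOn (modeFlux ν f u k j c) (Ioc 0 T) :=
  (integrableOn_Ioc_iff_integrableOn_Ioo (by finiteness)).2 (integrableOn_modeFlux hu hf k j c)

/-- The flux is a.e.-strongly measurable on `(0, T)`. [folklore] -/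
theorem aestronglyMeasurable_modeFlux (hu : IsLerayHopfOn T ν (fun _ => f) u₀ u) (hf : IsSmooth f)
    (k : d → ℤ) (j : d) (c : Bool) :
    AEStronglyMeasurable (modeFlux ν f u k j c) (volume.restrict (Ioo 0 T)) :=
  hu.aestronglyMeasurable_flux (aestronglyMeasurable_stLift_const hf _) (isSmooth_frameField k j c)

/-- The coordinates are continuous on `(0, T]` (weak `L²` continuity of the solution). [folklore] -/
theorem continuousOn_modeCoord (hu : IsLerayHopfOn T ν (fun _ => f) u₀ u) (k : d → ℤ) (j : d)
    (c : Bool) : ContinuousOn (modeCoord u k j c) (Ioc 0 T) :=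
  (hu.weak_continuous (frameField k j c) ((isSmooth_frameField k j c).memLp 2)).1

/-- The coordinates are bounded on `(0, T]`: `|V(τ)| ≤ ½(1 + C)` where `∫‖u(τ)‖² ≤ C` … we use
the cruder statement that they are bounded on every compact `[s, t] ⊆ (0, T]` (continuity). [folklore] -/
theorem exists_bound_modeCoord (hu : IsLerayHopfOn T ν (fun _ => f) u₀ u) (k : d → ℤ) (j : d)
    (c : Bool) {s t : ℝ} (hs : 0 < s) (htT : t ≤ T) :
    ∃ C : ℝ, ∀ τ ∈ Icc s t, |modeCoord u k j c τ| ≤ C := by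
  have hVc : ContinuousOn (modeCoord u k j c) (Icc s t) :=
    (continuousOn_modeCoord hu k j c).mono fun τ hτ => ⟨hs.trans_le hτ.1, hτ.2.trans htT⟩
  obtain ⟨C, hC⟩ := isCompact_Icc.exists_bound_of_continuousOn hVc
  exact ⟨C, fun τ hτ => by simpa [Real.norm_eq_abs] using hC τ hτ⟩

/-- The products `Φ_{k,j,c} V_{k,j,c}` are integrable on `(s, t]` for `0 < s`, `t ≤ T`. [folklore] -/
theorem integrableOn_modeFlux_mul_modeCoord (hu : IsLerayHopfOn T ν (fun _ => f) u₀ u) (hf : IsSmooth f)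
    (k : d → ℤ) (j : d) (c : Bool) {s t : ℝ} (hs : 0 < s) (htT : t ≤ T) :
    IntegrableOn (fun τ => modeFlux ν f u k j c τ * modeCoord u k j c τ) (Ioc s t) := by
  by_cases hst : s ≤ t
  · have hF : IntegrableOn (modeFlux ν f u k j c) (Ioc s t) :=
      (integrableOn_modeFlux_Ioc hu hf k j c).mono_set (Ioc_subset_Ioc hs.le htT)
    have hVc : ContinuousOn (modeCoord u k j c) (Icc s t) :=
      (continuousOn_modeCoord hu k j c).mono fun τ hτ => ⟨hs.trans_le hτ.1, hτ.2.trans htT⟩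
    obtain ⟨C, hC⟩ := isCompact_Icc.exists_bound_of_continuousOn hVc
    refine Integrable.mul_bdd hF ((hVc.mono Ioc_subset_Icc_self).aestronglyMeasurable measurableSet_Ioc)
      (c := C) ?_
    filter_upwards [ae_restrict_mem measurableSet_Ioc] with τ hτ
    exact hC τ (Ioc_subset_Icc_self hτ)
  · rw [Ioc_eq_empty (by push Not at hst ⊢; exact hst.le)]
    exact integrableOn_empty

/-- **The integral equation of the square of a coordinate**: for `0 < s ≤ t ≤ T`, `k ≠ 0`,
`V(t)² - V(s)² = 2∫_{(s,t]} Φ V` (`sq_sub_sq_eq_setIntegral_of_sub_eq_setIntegral`; Temam 1984,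
Ch. III Lemma 1.2, scalar case). [cite: Temam1984, Ch. III §1 Lemma 1.2] -/
theorem modeCoord_sq_sub_eq (hu : IsLerayHopfOn T ν (fun _ => f) u₀ u) (hT : 0 < T) (hf : IsSmooth f)
    {k : d → ℤ} (hk : k ≠ 0) (j : d) (c : Bool) {s t : ℝ} (hs : 0 < s) (hst : s ≤ t) (htT : t ≤ T) :
    modeCoord u k j c t ^ 2 - modeCoord u k j c s ^ 2 =
      2 * ∫ τ in Ioc s t, modeFlux ν f u k j c τ * modeCoord u k j c τ := by
  have hF : IntegrableOn (modeFlux ν f u k j c) (Ioc s t) :=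
    (integrableOn_modeFlux_Ioc hu hf k j c).mono_set (Ioc_subset_Ioc hs.le htT)
  exact sq_sub_sq_eq_setIntegral_of_sub_eq_setIntegral hst hF fun τ hτ =>
    modeCoord_sub_eq hu hT hf hk j c hs hτ.1 (hτ.2.trans htT)

end Modes

/-! ### The frame of the punctured ball: sums of coordinates -/

section Frame

variable {T ν : ℝ} {f : UnitAddTorus d → EuclideanSpace ℝ d}
  {u₀ : UnitAddTorus d → EuclideanSpace ℝ d} {u : ℝ → UnitAddTorus d → EuclideanSpace ℝ d}

/-- **Field-level frame identity at one frequency**: for transversal `z`,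
`∑ⱼ ∑_c Re⟪z, frameVec k j c⟫ • ψ_{k,j,c}(y) = Re (e_k(y) z)` (`Torus.sum_sum_re_inner_frameVec_smul`
under `Re (e_k(y) •)`). [folklore] -/
theorem sum_sum_re_inner_frameVec_smul_frameField {k : d → ℤ} {z : EuclideanSpace ℂ d}
    (hz : ∑ i, (k i : ℂ) * z i = 0) (y : UnitAddTorus d) :
    ∑ j, ∑ c, (inner ℂ z (frameVec k j c)).re • frameField k j c y = realTrigPoly {k} (fun _ => z) y := by
  have hψ : ∀ j c, frameField k j c y = EuclideanSpace.realPart (mFourier k y • frameVec k j c) := fun j c =>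
    realTrigPoly_singleton_apply k _ y
  simp_rw [hψ, smul_realPart_mFourier_smul, ← map_sum, ← Finset.smul_sum]
  rw [sum_sum_re_inner_frameVec_smul hz, realTrigPoly_singleton_apply]

/-- One-frequency Parseval for the pairings: if `ŵ(k)` is transversal then
`∑ⱼ ∑_c ⟨w, ψ_{k,j,c}⟩² = ‖ŵ(k)‖²`. [folklore] -/
theorem sum_sum_modePairing_sq {w : UnitAddTorus d → EuclideanSpace ℝ d} (hw : Integrable w volume)
    {k : d → ℤ} (hk : ∑ i, (k i : ℂ) * mFourierCoeff (EuclideanSpace.complexify ∘ w) k i = 0) :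
    ∑ j, ∑ c, modePairing k j c w ^ 2 = ‖mFourierCoeff (EuclideanSpace.complexify ∘ w) k‖ ^ 2 := by
  simp_rw [modePairing_eq_re hw]
  exact sum_sum_sq_re_inner_frameVec hk

/-- Polarised one-frequency Parseval: if `ŵ(k)` is transversal then for every `g`,
`∑ⱼ ∑_c ⟨g, ψ_{k,j,c}⟩ ⟨w, ψ_{k,j,c}⟩ = Re⟪ŵ(k), ĝ(k)⟫`. [folklore] -/
theorem sum_sum_modePairing_mul {w g : UnitAddTorus d → EuclideanSpace ℝ d} (hw : Integrable w volume)
    (hg : Integrable g volume) {k : d → ℤ}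
    (hk : ∑ i, (k i : ℂ) * mFourierCoeff (EuclideanSpace.complexify ∘ w) k i = 0) :
    ∑ j, ∑ c, modePairing k j c g * modePairing k j c w =
      (inner ℂ (mFourierCoeff (EuclideanSpace.complexify ∘ w) k)
        (mFourierCoeff (EuclideanSpace.complexify ∘ g) k)).re := by
  set z := mFourierCoeff (EuclideanSpace.complexify ∘ w) k with hz
  set a := mFourierCoeff (EuclideanSpace.complexify ∘ g) k with ha
  simp_rw [modePairing_eq_re hw, modePairing_eq_re hg]
  simp only [← hz, ← ha]
  have hrec := congrArg (fun v => (inner ℂ a v).re) (sum_sum_re_inner_frameVec_smul hk)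
  simp only [inner_sum, Complex.re_sum, inner_smul_right, Complex.re_ofReal_mul] at hrec
  have h2 : (inner ℂ z a).re = (inner ℂ a z).re := inner_re_symm (𝕜 := ℂ) z a
  rw [h2, ← hrec]
  refine Finset.sum_congr rfl fun j _ => Finset.sum_congr rfl fun c _ => ?_
  ring

/-- **The truncated enstrophy in coordinates**: `Z_N(τ) = ∑_J 4π²|k_J|² V_J(τ)²` over the frame
of the punctured ball `0 < |k| ≤ N`. [folklore] -/
def truncEnstrophy (u : ℝ → UnitAddTorus d → EuclideanSpace ℝ d) (N : ℕ) (τ : ℝ) : ℝ :=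
  ∑ J : FrameIdx d N, stokesEigenvalue (J.1 : d → ℤ) * modeCoord u J.1 J.2.1 J.2.2 τ ^ 2

/-- The summed trilinear rate `∑_J 4π²|k_J|² N_J(τ) V_J(τ)`. [folklore] -/
def nonlinRate (u : ℝ → UnitAddTorus d → EuclideanSpace ℝ d) (N : ℕ) (τ : ℝ) : ℝ :=
  ∑ J : FrameIdx d N, stokesEigenvalue (J.1 : d → ℤ) * (modeNonlin u J.1 J.2.1 J.2.2 τ * modeCoord u J.1 J.2.1 J.2.2 τ)

/-- The truncated palinstrophy rate `∑_J (4π²|k_J|²)² V_J(τ)²`. [folklore] -/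
def palinRate (u : ℝ → UnitAddTorus d → EuclideanSpace ℝ d) (N : ℕ) (τ : ℝ) : ℝ :=
  ∑ J : FrameIdx d N, stokesEigenvalue (J.1 : d → ℤ) ^ 2 * modeCoord u J.1 J.2.1 J.2.2 τ ^ 2

/-- The summed force rate `∑_J 4π²|k_J|² F_J V_J(τ)`. [folklore] -/
def forceRate (f : UnitAddTorus d → EuclideanSpace ℝ d) (u : ℝ → UnitAddTorus d → EuclideanSpace ℝ d)
    (N : ℕ) (τ : ℝ) : ℝ :=
  ∑ J : FrameIdx d N, stokesEigenvalue (J.1 : d → ℤ) * (modeForce f J.1 J.2.1 J.2.2 * modeCoord u J.1 J.2.1 J.2.2 τ)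

omit [DecidableEq d] in
/-- Sums over the frame index type as iterated sums over frequencies, directions and phases. [folklore] -/
theorem sum_frameIdx_eq [DecidableEq d] {N : ℕ} (φ : (d → ℤ) → d → Bool → ℝ) :
    ∑ J : FrameIdx d N, φ (J.1 : d → ℤ) J.2.1 J.2.2 = ∑ k ∈ freqBall₀ N, ∑ j, ∑ c, φ k j c := by
  rw [Fintype.sum_prod_type, ← Finset.sum_coe_sort (freqBall₀ N)]
  refine Finset.sum_congr rfl fun k _ => ?_
  rw [Fintype.sum_prod_type]

/-- **The truncated enstrophy is the enstrophy of the truncation**: for `τ ∈ (0, T]`,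
`Z_N(τ) = ∑_{0<|k|≤N} 4π²|k|² ‖û(τ)(k)‖² = ‖∇P_N u(τ)‖₂²` (one-frequency Parseval, the
slice being weakly divergence free). [folklore] -/
theorem truncEnstrophy_eq_sum (hu : IsLerayHopfOn T ν (fun _ => f) u₀ u) {τ : ℝ} (hτ : τ ∈ Ioc 0 T)
    (N : ℕ) :
    truncEnstrophy u N τ = ∑ k ∈ freqBall₀ N, stokesEigenvalue k *
      ‖mFourierCoeff (EuclideanSpace.complexify ∘ u τ) k‖ ^ 2 := by
  have hint : Integrable (u τ) volume := (hu.memLp τ ⟨hτ.1.le, hτ.2⟩).integrable one_le_two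
  rw [truncEnstrophy, sum_frameIdx_eq (fun k j c => stokesEigenvalue k * modeCoord u k j c τ ^ 2)]
  refine Finset.sum_congr rfl fun k _ => ?_
  simp_rw [← Finset.mul_sum]
  simp only [modeCoord]
  rw [sum_sum_modePairing_sq hint (hu.sum_mul_mFourierCoeff_slice hτ k)]

/-- The truncated enstrophy as the spectral enstrophy of the truncation, for `τ ∈ (0, T]`:
`Z_N(τ) = (‖∇P_N u(τ)‖₂²).toReal`. [folklore] -/
theorem truncEnstrophy_eq_toReal (hu : IsLerayHopfOn T ν (fun _ => f) u₀ u) {τ : ℝ} (hτ : τ ∈ Ioc 0 T)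
    (N : ℕ) :
    truncEnstrophy u N τ = (eGradNormSq (fourierTruncate N (u τ))).toReal := by
  have hint : Integrable (u τ) volume := (hu.memLp τ ⟨hτ.1.le, hτ.2⟩).integrable one_le_two
  rw [truncEnstrophy_eq_sum hu hτ, eGradNormSq_fourierTruncate_eq_sum hint,
    ENNReal.toReal_mul, ENNReal.toReal_ofReal (by positivity), ENNReal.toReal_sum fun k _ =>
      ENNReal.mul_ne_top ENNReal.ofReal_ne_top (ENNReal.pow_ne_top (by simp)),
    Finset.mul_sum, freqBall₀, ← Finset.add_sum_erase _ _ (zero_mem_freqBall N)]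
  simp only [freqNormSq_zero, ENNReal.ofReal_zero, zero_mul, ENNReal.toReal_zero, mul_zero, zero_add]
  refine Finset.sum_congr rfl fun k _ => ?_
  rw [ENNReal.toReal_mul, ENNReal.toReal_ofReal (freqNormSq_nonneg k), ← ofReal_norm,
    ← ENNReal.ofReal_pow (norm_nonneg _), ENNReal.toReal_ofReal (sq_nonneg _), stokesEigenvalue]
  ring

/-- The truncated palinstrophy rate in Fourier variables, for `τ ∈ (0, T]`:
`P_N(τ) = ∑_{0<|k|≤N} (4π²|k|²)² ‖û(τ)(k)‖²`. [folklore] -/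
theorem palinRate_eq_sum (hu : IsLerayHopfOn T ν (fun _ => f) u₀ u) {τ : ℝ} (hτ : τ ∈ Ioc 0 T)
    (N : ℕ) :
    palinRate u N τ = ∑ k ∈ freqBall₀ N, stokesEigenvalue k ^ 2 *
      ‖mFourierCoeff (EuclideanSpace.complexify ∘ u τ) k‖ ^ 2 := by
  have hint : Integrable (u τ) volume := (hu.memLp τ ⟨hτ.1.le, hτ.2⟩).integrable one_le_two
  rw [palinRate, sum_frameIdx_eq (fun k j c => stokesEigenvalue k ^ 2 * modeCoord u k j c τ ^ 2)]
  refine Finset.sum_congr rfl fun k _ => ?_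
  simp_rw [← Finset.mul_sum]
  simp only [modeCoord]
  rw [sum_sum_modePairing_sq hint (hu.sum_mul_mFourierCoeff_slice hτ k)]

/-- The summed force rate in Fourier variables, for `τ ∈ (0, T]` and smooth `f`:
`∑_J 4π²|k_J|² F_J V_J(τ) = ∑_{0<|k|≤N} 4π²|k|² Re⟪û(τ)(k), f̂(k)⟫`. [folklore] -/
theorem forceRate_eq_sum (hu : IsLerayHopfOn T ν (fun _ => f) u₀ u) (hf : IsSmooth f) {τ : ℝ}
    (hτ : τ ∈ Ioc 0 T) (N : ℕ) :
    forceRate f u N τ = ∑ k ∈ freqBall₀ N, stokesEigenvalue k *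
      (inner ℂ (mFourierCoeff (EuclideanSpace.complexify ∘ u τ) k)
        (mFourierCoeff (EuclideanSpace.complexify ∘ f) k)).re := by
  have hint : Integrable (u τ) volume := (hu.memLp τ ⟨hτ.1.le, hτ.2⟩).integrable one_le_two
  rw [forceRate, sum_frameIdx_eq (fun k j c => stokesEigenvalue k * (modeForce f k j c * modeCoord u k j c τ))]
  refine Finset.sum_congr rfl fun k _ => ?_
  simp_rw [← Finset.mul_sum]
  simp only [modeCoord, modeForce]
  rw [← sum_sum_modePairing_mul hint hf.integrable (hu.sum_mul_mFourierCoeff_slice hτ k)]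
  rfl

/-- **The field spanned by the weighted coordinates is the truncated Stokes operator applied to
the slice**: for `τ ∈ (0, T]` and every `y`,
`∑_J 4π²|k_J|² V_J(τ) • ψ_J(y) = -Δ P_N u(τ)(y)`. [folklore] -/
theorem sum_stokesEig_mul_modeCoord_smul_frameField (hu : IsLerayHopfOn T ν (fun _ => f) u₀ u)
    {τ : ℝ} (hτ : τ ∈ Ioc 0 T) (N : ℕ) (y : UnitAddTorus d) :
    ∑ J : FrameIdx d N, (stokesEigenvalue (J.1 : d → ℤ) * modeCoord u J.1 J.2.1 J.2.2 τ) • frameField (J.1 : d → ℤ) J.2.1 J.2.2 y =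
      -FunctionSpaces.Torus.laplacian (fourierTruncate N (u τ)) y := by
  have hint : Integrable (u τ) volume := (hu.memLp τ ⟨hτ.1.le, hτ.2⟩).integrable one_le_two
  set û : (d → ℤ) → EuclideanSpace ℂ d := fun k => mFourierCoeff (EuclideanSpace.complexify ∘ u τ) k with hû
  -- the left side frequency by frequency
  have hL : ∑ J : FrameIdx d N, (stokesEigenvalue (J.1 : d → ℤ) * modeCoord u J.1 J.2.1 J.2.2 τ) •
      frameField (J.1 : d → ℤ) J.2.1 J.2.2 y =
      ∑ k ∈ freqBall₀ N, EuclideanSpace.realPart (mFourier k y • (((stokesEigenvalue k : ℝ) : ℂ) • û k)) := by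
    have h := Fintype.sum_prod_type (fun J : FrameIdx d N =>
      (stokesEigenvalue (J.1 : d → ℤ) * modeCoord u J.1 J.2.1 J.2.2 τ) • frameField (J.1 : d → ℤ) J.2.1 J.2.2 y)
    rw [h, ← Finset.sum_coe_sort (freqBall₀ N)]
    refine Finset.sum_congr rfl fun k _ => ?_
    rw [Fintype.sum_prod_type]
    simp_rw [mul_smul, ← Finset.smul_sum]
    simp only [modeCoord]
    simp_rw [modePairing_eq_re hint]
    rw [sum_sum_re_inner_frameVec_smul_frameField (hu.sum_mul_mFourierCoeff_slice hτ k),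
      ← realTrigPoly_singleton_real_smul, realTrigPoly_singleton_apply]
  -- the right side
  have hR : -FunctionSpaces.Torus.laplacian (fourierTruncate N (u τ)) y =
      ∑ k ∈ freqBall N, EuclideanSpace.realPart (mFourier k y • (((stokesEigenvalue k : ℝ) : ℂ) • û k)) := by
    rw [laplacian_fourierTruncate_apply, realTrigPoly_apply_eq_sum, ← Finset.sum_neg_distrib]
    refine Finset.sum_congr rfl fun k _ => ?_
    rw [smul_neg, map_neg, neg_neg]
    rfl
  rw [hL, hR, freqBall₀, ← Finset.add_sum_erase _ _ (zero_mem_freqBall N)]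
  have h0 : EuclideanSpace.realPart (mFourier (0 : d → ℤ) y • (((stokesEigenvalue (0 : d → ℤ) : ℝ) : ℂ) • û 0)) = 0 := by
    simp [stokesEigenvalue, freqNormSq_zero]
  rw [h0, zero_add]

/-- **The summed trilinear rate is the trilinear term against the truncated Stokes operator**:
for `τ ∈ (0, T]`, `∑_J 4π²|k_J|² N_J(τ) V_J(τ) = -∫⟪u(τ), (u(τ)·∇) ΔP_N u(τ)⟫`. [folklore] -/
theorem nonlinRate_eq (hu : IsLerayHopfOn T ν (fun _ => f) u₀ u) {τ : ℝ} (hτ : τ ∈ Ioc 0 T) (N : ℕ) :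
    nonlinRate u N τ =
      -∫ x, ⟪u τ x, FunctionSpaces.Torus.convect (u τ) (FunctionSpaces.Torus.laplacian (fourierTruncate N (u τ))) x⟫ := by
  have hmem : MemLp (u τ) 2 volume := hu.memLp τ ⟨hτ.1.le, hτ.2⟩
  have hΨ : ∀ J : FrameIdx d N, IsSmooth (frameField (J.1 : d → ℤ) J.2.1 J.2.2) := fun J =>
    isSmooth_frameField _ _ _
  set cJ : FrameIdx d N → ℝ := fun J => stokesEigenvalue (J.1 : d → ℤ) * modeCoord u J.1 J.2.1 J.2.2 τ with hcJ
  -- the trilinear pairing is linear in the test field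
  have hlin : ∀ x, FunctionSpaces.Torus.convect (u τ)
      (fun y => ∑ J : FrameIdx d N, cJ J • frameField (J.1 : d → ℤ) J.2.1 J.2.2 y) x =
      ∑ J : FrameIdx d N, cJ J • FunctionSpaces.Torus.convect (u τ) (frameField (J.1 : d → ℤ) J.2.1 J.2.2) x :=
    fun x => convect_finset_sum_smul Finset.univ cJ hΨ (u τ) x
  have hfield : (fun y => ∑ J : FrameIdx d N, cJ J • frameField (J.1 : d → ℤ) J.2.1 J.2.2 y) =
      fun y => (-1 : ℝ) • FunctionSpaces.Torus.laplacian (fourierTruncate N (u τ)) y := by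
    funext y
    rw [neg_one_smul]
    exact sum_stokesEig_mul_modeCoord_smul_frameField hu hτ N y
  have hint : ∀ J : FrameIdx d N, Integrable (fun x => cJ J *
      ⟪u τ x, FunctionSpaces.Torus.convect (u τ) (frameField (J.1 : d → ℤ) J.2.1 J.2.2) x⟫) volume := fun J =>
    (integrable_inner_convect_self hmem (hΨ J)).const_mul _
  calc nonlinRate u N τ
      = ∑ J : FrameIdx d N, cJ J * modeNonlin u J.1 J.2.1 J.2.2 τ := by
        rw [nonlinRate]
        exact Finset.sum_congr rfl fun J _ => by rw [hcJ]; ring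
    _ = ∑ J : FrameIdx d N, ∫ x, cJ J *
          ⟪u τ x, FunctionSpaces.Torus.convect (u τ) (frameField (J.1 : d → ℤ) J.2.1 J.2.2) x⟫ := by
        refine Finset.sum_congr rfl fun J _ => ?_
        rw [modeNonlin, integral_const_mul]
    _ = ∫ x, ∑ J : FrameIdx d N, cJ J *
          ⟪u τ x, FunctionSpaces.Torus.convect (u τ) (frameField (J.1 : d → ℤ) J.2.1 J.2.2) x⟫ :=
        (integral_finsetSum _ fun J _ => hint J).symm
    _ = ∫ x, ⟪u τ x, FunctionSpaces.Torus.convect (u τ)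
          (fun y => ∑ J : FrameIdx d N, cJ J • frameField (J.1 : d → ℤ) J.2.1 J.2.2 y) x⟫ := by
        refine integral_congr_ae (ae_of_all _ fun x => ?_)
        dsimp only
        rw [hlin, inner_sum]
        exact Finset.sum_congr rfl fun J _ => by rw [real_inner_smul_right]
    _ = -∫ x, ⟪u τ x, FunctionSpaces.Torus.convect (u τ) (FunctionSpaces.Torus.laplacian (fourierTruncate N (u τ))) x⟫ := by
        rw [hfield, ← integral_neg]
        refine integral_congr_ae (ae_of_all _ fun x => ?_)
        dsimp only
        rw [convect_const_smul (u τ) ((isSmooth_fourierTruncate N (u τ)).laplacian.isContDiff (by simp)),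
          real_inner_smul_right, neg_one_mul]

/-- **The rate decomposes**: for `u(τ) ∈ L²` and a smooth `f`,
`∑_J 4π²|k_J|² Φ_J(τ) V_J(τ) = (∑ 4π²|k|² N V) - ν (∑ (4π²|k|²)² V²) + (∑ 4π²|k|² F V)`. [folklore] -/
theorem sum_stokesEig_mul_modeFlux_mul_modeCoord {τ : ℝ} (huτ : MemLp (u τ) 2 volume) (hf : IsSmooth f)
    (N : ℕ) :
    ∑ J : FrameIdx d N, stokesEigenvalue (J.1 : d → ℤ) * (modeFlux ν f u J.1 J.2.1 J.2.2 τ * modeCoord u J.1 J.2.1 J.2.2 τ) =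
      nonlinRate u N τ - ν * palinRate u N τ + forceRate f u N τ := by
  rw [nonlinRate, palinRate, forceRate, Finset.mul_sum, ← Finset.sum_sub_distrib, ← Finset.sum_add_distrib]
  refine Finset.sum_congr rfl fun J _ => ?_
  rw [modeFlux_eq huτ hf]
  ring

/-- The truncated palinstrophy rate is continuous on `(0, T]`. [folklore] -/
theorem continuousOn_palinRate (hu : IsLerayHopfOn T ν (fun _ => f) u₀ u) (N : ℕ) :
    ContinuousOn (palinRate u N) (Ioc 0 T) :=
  continuousOn_finsetSum _ fun _ _ => continuousOn_const.mul ((continuousOn_modeCoord hu _ _ _).pow 2)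

/-- The summed force rate is continuous on `(0, T]`. [folklore] -/
theorem continuousOn_forceRate (hu : IsLerayHopfOn T ν (fun _ => f) u₀ u) (N : ℕ) :
    ContinuousOn (forceRate f u N) (Ioc 0 T) :=
  continuousOn_finsetSum _ fun _ _ => continuousOn_const.mul (continuousOn_const.mul
    (continuousOn_modeCoord hu _ _ _))

/-- A function continuous on `(0, T]` is integrable on `(s, t]` for `0 < s`, `t ≤ T`. [folklore] -/
theorem integrableOn_Ioc_of_continuousOn_Ioc {φ : ℝ → ℝ} (hφ : ContinuousOn φ (Ioc 0 T)) {s t : ℝ}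
    (hs : 0 < s) (htT : t ≤ T) : IntegrableOn φ (Ioc s t) :=
  ((hφ.mono fun _τ hτ => ⟨hs.trans_le hτ.1, hτ.2.trans htT⟩).integrableOn_compact isCompact_Icc).mono_set
    Ioc_subset_Icc_self

/-- The summed trilinear rate is integrable on `(s, t]` for `0 < s`, `t ≤ T` (it is the
integrable combination `∑ 4π²|k|² Φ V + ν P_N - ∑ 4π²|k|² F V`). [folklore] -/
theorem integrableOn_nonlinRate (hu : IsLerayHopfOn T ν (fun _ => f) u₀ u) (hf : IsSmooth f) (N : ℕ)
    {s t : ℝ} (hs : 0 < s) (htT : t ≤ T) : IntegrableOn (nonlinRate u N) (Ioc s t) := by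
  have h1 : IntegrableOn (fun τ => ∑ J : FrameIdx d N, stokesEigenvalue (J.1 : d → ℤ) *
      (modeFlux ν f u J.1 J.2.1 J.2.2 τ * modeCoord u J.1 J.2.1 J.2.2 τ)) (Ioc s t) :=
    integrable_finsetSum _ fun J _ =>
      (integrableOn_modeFlux_mul_modeCoord hu hf _ _ _ hs htT).const_mul _
  have h2 : IntegrableOn (palinRate u N) (Ioc s t) :=
    integrableOn_Ioc_of_continuousOn_Ioc (continuousOn_palinRate hu N) hs htT
  have h3 : IntegrableOn (forceRate f u N) (Ioc s t) :=
    integrableOn_Ioc_of_continuousOn_Ioc (continuousOn_forceRate hu N) hs htT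
  refine ((h1.add (h2.const_mul ν)).sub h3).congr_fun (fun τ hτ => ?_) measurableSet_Ioc
  have huτ : MemLp (u τ) 2 volume := hu.memLp τ ⟨(hs.trans hτ.1).le, hτ.2.trans htT⟩
  simp only [Pi.add_apply, Pi.sub_apply]
  rw [sum_stokesEig_mul_modeFlux_mul_modeCoord huτ hf N]
  ring

/-- **The enstrophy identity of the truncations of a Leray–Hopf solution**: for a steady smooth
force and `0 < s ≤ t ≤ T`,
`Z_N(t) - Z_N(s) = 2∫_{(s,t]} (∑4π²|k|² N V - ν ∑(4π²|k|²)² V² + ∑ 4π²|k|² F V)`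
(the coordinate identities squared, `modeCoord_sq_sub_eq`, weighted by `4π²|k|²` and summed over
the frame of `0 < |k| ≤ N`; this is the Galerkin-type enstrophy balance of FMRT 2001, (A.55),
for the truncation `P_N u` of the weak solution itself). [cite: FoiasManleyRosaTemam2001, App. II.A (A.55)] -/
theorem truncEnstrophy_sub_eq (hu : IsLerayHopfOn T ν (fun _ => f) u₀ u) (hT : 0 < T) (hf : IsSmooth f)
    {s t : ℝ} (hs : 0 < s) (hst : s ≤ t) (htT : t ≤ T) (N : ℕ) :
    truncEnstrophy u N t - truncEnstrophy u N s =
      2 * ∫ τ in Ioc s t, (nonlinRate u N τ - ν * palinRate u N τ + forceRate f u N τ) := by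
  have hJ : ∀ J : FrameIdx d N,
      stokesEigenvalue (J.1 : d → ℤ) * modeCoord u J.1 J.2.1 J.2.2 t ^ 2 -
        stokesEigenvalue (J.1 : d → ℤ) * modeCoord u J.1 J.2.1 J.2.2 s ^ 2 =
      2 * ∫ τ in Ioc s t, stokesEigenvalue (J.1 : d → ℤ) *
        (modeFlux ν f u J.1 J.2.1 J.2.2 τ * modeCoord u J.1 J.2.1 J.2.2 τ) := by
    intro J
    rw [← mul_sub, modeCoord_sq_sub_eq hu hT hf (ne_zero_of_mem_freqBall₀ J.1) _ _ hs hst htT,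
      integral_const_mul]
    ring
  have hint := integral_finsetSum (Finset.univ : Finset (FrameIdx d N)) (μ := volume.restrict (Ioc s t))
    (f := fun J τ => stokesEigenvalue (J.1 : d → ℤ) * (modeFlux ν f u J.1 J.2.1 J.2.2 τ * modeCoord u J.1 J.2.1 J.2.2 τ))
    fun J _ => (integrableOn_modeFlux_mul_modeCoord hu hf _ _ _ hs htT).const_mul _
  have hdec : ∫ τ in Ioc s t, ∑ J : FrameIdx d N, stokesEigenvalue (J.1 : d → ℤ) *
      (modeFlux ν f u J.1 J.2.1 J.2.2 τ * modeCoord u J.1 J.2.1 J.2.2 τ) =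
      ∫ τ in Ioc s t, (nonlinRate u N τ - ν * palinRate u N τ + forceRate f u N τ) := by
    refine setIntegral_congr_fun measurableSet_Ioc fun τ hτ => ?_
    exact sum_stokesEig_mul_modeFlux_mul_modeCoord (hu.memLp τ ⟨(hs.trans hτ.1).le, hτ.2.trans htT⟩) hf N
  rw [truncEnstrophy, truncEnstrophy, ← Finset.sum_sub_distrib, Finset.sum_congr rfl fun J _ => hJ J,
    ← Finset.mul_sum, ← hint, hdec]

end Frame

/-! ### Pointwise limits of the rates as `N → ∞` -/

section Limits

variable {T ν : ℝ} {f : UnitAddTorus d → EuclideanSpace ℝ d}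
  {u₀ : UnitAddTorus d → EuclideanSpace ℝ d} {u : ℝ → UnitAddTorus d → EuclideanSpace ℝ d}

/-- The truncated palinstrophy rate as the `toReal` of a partial sum of the palinstrophy series,
for `τ ∈ (0, T]`. [folklore] -/
theorem palinRate_eq_toReal (hu : IsLerayHopfOn T ν (fun _ => f) u₀ u) {τ : ℝ} (hτ : τ ∈ Ioc 0 T)
    (N : ℕ) :
    palinRate u N τ = (ENNReal.ofReal (16 * Real.pi ^ 4) * ∑ k ∈ freqBall N,
      ENNReal.ofReal (freqNormSq k ^ (2 : ℝ)) * ‖mFourierCoeff (EuclideanSpace.complexify ∘ u τ) k‖ₑ ^ 2).toReal := by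
  rw [palinRate_eq_sum hu hτ, ENNReal.toReal_mul, ENNReal.toReal_ofReal (by positivity),
    ENNReal.toReal_sum fun k _ => ENNReal.mul_ne_top ENNReal.ofReal_ne_top (ENNReal.pow_ne_top (by simp)),
    Finset.mul_sum, freqBall₀, ← Finset.add_sum_erase _ _ (zero_mem_freqBall N)]
  simp only [freqNormSq_zero, Real.zero_rpow two_ne_zero, ENNReal.ofReal_zero, zero_mul,
    ENNReal.toReal_zero, mul_zero, zero_add]
  refine Finset.sum_congr rfl fun k _ => ?_
  rw [ENNReal.toReal_mul, Real.rpow_two, ENNReal.toReal_ofReal (sq_nonneg _), ← ofReal_norm,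
    ← ENNReal.ofReal_pow (norm_nonneg _), ENNReal.toReal_ofReal (sq_nonneg _), stokesEigenvalue]
  ring

/-- **The truncated palinstrophy rates increase to the palinstrophy**: at a time `τ ∈ (0, T]` with
`‖Δu(τ)‖₂ < ∞`, `P_N(τ) → (‖Δu(τ)‖₂²).toReal`. [folklore] -/
theorem tendsto_palinRate (hu : IsLerayHopfOn T ν (fun _ => f) u₀ u) {τ : ℝ} (hτ : τ ∈ Ioc 0 T)
    (hfin : eLaplacianNormSq (u τ) ≠ ⊤) :
    Tendsto (fun N => palinRate u N τ) atTop (𝓝 (eLaplacianNormSq (u τ)).toReal) := by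
  have hsum : HasSum (fun k : d → ℤ => ENNReal.ofReal (freqNormSq k ^ (2 : ℝ)) *
      ‖mFourierCoeff (EuclideanSpace.complexify ∘ u τ) k‖ₑ ^ 2)
      (∑' k : d → ℤ, ENNReal.ofReal (freqNormSq k ^ (2 : ℝ)) *
        ‖mFourierCoeff (EuclideanSpace.complexify ∘ u τ) k‖ₑ ^ 2) := ENNReal.summable.hasSum
  have h1 := (ENNReal.Tendsto.const_mul (a := ENNReal.ofReal (16 * Real.pi ^ 4))
    (hsum.comp tendsto_freqBall_atTop) (Or.inr ENNReal.ofReal_ne_top))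
  rw [← eLaplacianNormSq_eq_tsum'] at h1
  have h2 := (ENNReal.tendsto_toReal hfin).comp h1
  refine h2.congr fun N => ?_
  simp only [Function.comp_apply]
  rw [palinRate_eq_toReal hu hτ N]

/-- The truncated palinstrophy rate is dominated by the palinstrophy at every time `τ ∈ (0, T]`
with `‖Δu(τ)‖₂ < ∞`. [folklore] -/
theorem palinRate_le (hu : IsLerayHopfOn T ν (fun _ => f) u₀ u) {τ : ℝ} (hτ : τ ∈ Ioc 0 T)
    (hfin : eLaplacianNormSq (u τ) ≠ ⊤) (N : ℕ) : palinRate u N τ ≤ (eLaplacianNormSq (u τ)).toReal := by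
  rw [palinRate_eq_toReal hu hτ N]
  refine ENNReal.toReal_mono hfin ?_
  rw [eLaplacianNormSq_eq_tsum']
  exact mul_le_mul_right (ENNReal.sum_le_tsum _) _

omit [DecidableEq d] in
/-- The truncated palinstrophy rate is nonnegative. [folklore] -/
theorem palinRate_nonneg [DecidableEq d] (u : ℝ → UnitAddTorus d → EuclideanSpace ℝ d) (N : ℕ) (τ : ℝ) :
    0 ≤ palinRate u N τ :=
  Finset.sum_nonneg fun _ _ => mul_nonneg (sq_nonneg _) (sq_nonneg _)

/-- **The summed force rates converge to `-(Δf, u(τ))`** at every `τ ∈ (0, T]` (Parseval: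
`∫⟪u, Δf⟫ = ∑ Re⟪û(k), 𝓕(Δf)(k)⟫ = -∑ 4π²|k|² Re⟪û(k), f̂(k)⟫`). [folklore] -/
theorem tendsto_forceRate (hu : IsLerayHopfOn T ν (fun _ => f) u₀ u) (hf : IsSmooth f) {τ : ℝ}
    (hτ : τ ∈ Ioc 0 T) :
    Tendsto (fun N => forceRate f u N τ) atTop (𝓝 (-∫ x, ⟪FunctionSpaces.Torus.laplacian f x, u τ x⟫)) := by
  have hmem : MemLp (u τ) 2 volume := hu.memLp τ ⟨hτ.1.le, hτ.2⟩
  have hpar := hasSum_re_inner_mFourierCoeff_complexify hmem (hf.laplacian.memLp 2)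
  have hcomm : ∫ x, ⟪FunctionSpaces.Torus.laplacian f x, u τ x⟫ = ∫ x, ⟪u τ x, FunctionSpaces.Torus.laplacian f x⟫ :=
    integral_congr_ae (ae_of_all _ fun x => real_inner_comm _ _)
  have hterm : ∀ k : d → ℤ, (inner ℂ (mFourierCoeff (EuclideanSpace.complexify ∘ u τ) k)
      (mFourierCoeff (EuclideanSpace.complexify ∘ FunctionSpaces.Torus.laplacian f) k)).re =
      -(stokesEigenvalue k * (inner ℂ (mFourierCoeff (EuclideanSpace.complexify ∘ u τ) k)
        (mFourierCoeff (EuclideanSpace.complexify ∘ f) k)).re) := by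
    intro k
    rw [mFourierCoeff_complexify_laplacian hf, inner_neg_right, Complex.neg_re, inner_smul_right,
      Complex.re_ofReal_mul, stokesEigenvalue]
  simp_rw [hterm] at hpar
  have h1 := (hpar.neg).comp tendsto_freqBall_atTop
  simp only [neg_neg] at h1
  rw [hcomm]
  refine h1.congr fun N => ?_
  rw [Function.comp_apply, forceRate_eq_sum hu hf hτ N, freqBall₀, ← Finset.add_sum_erase _ _ (zero_mem_freqBall N)]
  simp [stokesEigenvalue, freqNormSq_zero]

/-- Finite Bessel-type bound: `∑_{k∈S} 4π²|k|² ‖û(k)‖ ‖f̂(k)‖ ≤ ½(∫‖u‖² + ∫‖Δf‖²)` for `u ∈ L²`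
and smooth `f` (Cauchy–Schwarz, `4π²|k|² f̂(k) = -𝓕(Δf)(k)`, Bessel twice). [folklore] -/
theorem sum_stokesEig_mul_norm_mul_norm_le {v : UnitAddTorus d → EuclideanSpace ℝ d} (hv : MemLp v 2 volume)
    (hf : IsSmooth f) (S : Finset (d → ℤ)) :
    ∑ k ∈ S, stokesEigenvalue k * (‖mFourierCoeff (EuclideanSpace.complexify ∘ v) k‖ *
      ‖mFourierCoeff (EuclideanSpace.complexify ∘ f) k‖) ≤
      2⁻¹ * ((∫ x, ‖v x‖ ^ 2) + ∫ x, ‖FunctionSpaces.Torus.laplacian f x‖ ^ 2) := by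
  have hterm : ∀ k ∈ S, stokesEigenvalue k * (‖mFourierCoeff (EuclideanSpace.complexify ∘ v) k‖ *
      ‖mFourierCoeff (EuclideanSpace.complexify ∘ f) k‖) =
      ‖mFourierCoeff (EuclideanSpace.complexify ∘ v) k‖ *
        ‖mFourierCoeff (EuclideanSpace.complexify ∘ FunctionSpaces.Torus.laplacian f) k‖ := by
    intro k _
    rw [mFourierCoeff_complexify_laplacian hf, norm_neg, norm_smul, Complex.norm_real, Real.norm_eq_abs,
      abs_of_nonneg (mul_nonneg (by positivity) (freqNormSq_nonneg k) : (0 : ℝ) ≤ 4 * Real.pi ^ 2 * freqNormSq k),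
      stokesEigenvalue]
    ring
  rw [Finset.sum_congr rfl hterm]
  have hcs : ∀ k ∈ S, ‖mFourierCoeff (EuclideanSpace.complexify ∘ v) k‖ *
      ‖mFourierCoeff (EuclideanSpace.complexify ∘ FunctionSpaces.Torus.laplacian f) k‖ ≤
      2⁻¹ * (‖mFourierCoeff (EuclideanSpace.complexify ∘ v) k‖ ^ 2 +
        ‖mFourierCoeff (EuclideanSpace.complexify ∘ FunctionSpaces.Torus.laplacian f) k‖ ^ 2) := by
    intro k _
    nlinarith [two_mul_le_add_sq ‖mFourierCoeff (EuclideanSpace.complexify ∘ v) k‖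
      ‖mFourierCoeff (EuclideanSpace.complexify ∘ FunctionSpaces.Torus.laplacian f) k‖]
  refine (Finset.sum_le_sum hcs).trans ?_
  rw [← Finset.mul_sum, Finset.sum_add_distrib]
  gcongr
  · exact sum_le_hasSum S (fun k _ => sq_nonneg _) (hasSum_sq_norm_mFourierCoeff_complexify hv)
  · exact sum_le_hasSum S (fun k _ => sq_nonneg _) (hasSum_sq_norm_mFourierCoeff_complexify (hf.laplacian.memLp 2))

/-- The summed force rate is dominated by `½(∫‖u(τ)‖² + ∫‖Δf‖²)` at every `τ ∈ (0, T]`. [folklore] -/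
theorem abs_forceRate_le (hu : IsLerayHopfOn T ν (fun _ => f) u₀ u) (hf : IsSmooth f) {τ : ℝ}
    (hτ : τ ∈ Ioc 0 T) (N : ℕ) :
    |forceRate f u N τ| ≤ 2⁻¹ * ((∫ x, ‖u τ x‖ ^ 2) + ∫ x, ‖FunctionSpaces.Torus.laplacian f x‖ ^ 2) := by
  have hmem : MemLp (u τ) 2 volume := hu.memLp τ ⟨hτ.1.le, hτ.2⟩
  rw [forceRate_eq_sum hu hf hτ N]
  refine (Finset.abs_sum_le_sum_abs _ _).trans ((Finset.sum_le_sum fun k _ => ?_).trans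
    (sum_stokesEig_mul_norm_mul_norm_le hmem hf (freqBall₀ N)))
  rw [abs_mul, abs_of_nonneg (stokesEigenvalue_nonneg k)]
  refine mul_le_mul_of_nonneg_left ((Complex.abs_re_le_norm _).trans (norm_inner_le_norm _ _))
    (stokesEigenvalue_nonneg k)

end Limits

/-! ### Two dimensions: the trilinear rate, dominated convergence, and the balance -/

section TwoD

/-- Local notation for the flat unit two-torus `𝕋² = UnitAddTorus (Fin 2)`. -/
local notation "𝕋²" => UnitAddTorus (Fin 2)
/-- Local notation for velocity values `ℝ² = EuclideanSpace ℝ (Fin 2)`. -/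
local notation "ℝ²" => EuclideanSpace ℝ (Fin 2)

variable {T ν : ℝ} {f : 𝕋² → ℝ²} {u₀ : 𝕋² → ℝ²} {u : ℝ → 𝕋² → ℝ²}

/-- The mean mode is bounded by the `L²` norm: `‖û(0)‖ ≤ (∫‖u‖²)^{1/2}` (Bessel, one term). [folklore] -/
theorem norm_mFourierCoeff_zero_le_sqrt {d : Type*} [Fintype d] {v : UnitAddTorus d → EuclideanSpace ℝ d}
    (hv : MemLp v 2 volume) :
    ‖mFourierCoeff (EuclideanSpace.complexify ∘ v) 0‖ ≤ Real.sqrt (∫ x, ‖v x‖ ^ 2) := by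
  refine Real.le_sqrt_of_sq_le ?_
  have h := sum_le_hasSum {(0 : d → ℤ)} (fun k _ => sq_nonneg _) (hasSum_sq_norm_mFourierCoeff_complexify hv)
  rwa [Finset.sum_singleton] at h

/-- **The summed trilinear rate is small in the mean**: at a time `τ ∈ (0, T]` at which
`‖∇u(τ)‖₂² ≤ B` and `‖Δu(τ)‖₂ < ∞`,
`|∑_J 4π²|k_J|² N_J V_J| ≤ (2B)^{1/2} (½(∫‖u(τ)‖² + ‖Δu(τ)‖₂²) + (√Σ₄/4π²) ‖Δu(τ)‖₂²)`
(`nonlinRate_eq` and the slicewise estimate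
`Torus.abs_integral_inner_convect_laplacian_fourierTruncate_le`, with `tail_N ≤ ‖Δu‖₂²`,
`‖û(0)‖ ≤ ‖u‖_{L²}` and `ab ≤ ½(a² + b²)`). [cite: FoiasManleyRosaTemam2001, App. II.A (A.62)] -/
theorem abs_nonlinRate_le (hu : IsLerayHopfOn T ν (fun _ => f) u₀ u) {τ : ℝ} (hτ : τ ∈ Ioc 0 T)
    {B : ℝ≥0} (hB : eGradNormSq (u τ) ≤ B) (hfin : eLaplacianNormSq (u τ) ≠ ⊤) (N : ℕ) :
    |nonlinRate u N τ| ≤ Real.sqrt (2 * B) *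
      (2⁻¹ * ((∫ x, ‖u τ x‖ ^ 2) + (eLaplacianNormSq (u τ)).toReal) +
        Real.sqrt latticeSumFour / (4 * Real.pi ^ 2) * (eLaplacianNormSq (u τ)).toReal) := by
  have hmem : MemLp (u τ) 2 volume := hu.memLp τ ⟨hτ.1.le, hτ.2⟩
  have hdiv := hu.isWeaklyDivFree_of_mem_Ioc hτ
  have hgrad : eGradNormSq (u τ) ≠ ⊤ := ne_top_of_le_ne_top ENNReal.coe_ne_top hB
  set P : ℝ := (eLaplacianNormSq (u τ)).toReal with hP
  set E : ℝ := ∫ x, ‖u τ x‖ ^ 2 with hE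
  have hP0 : 0 ≤ P := ENNReal.toReal_nonneg
  have hE0 : 0 ≤ E := integral_nonneg fun x => sq_nonneg _
  rw [nonlinRate_eq hu hτ N, abs_neg]
  refine (abs_integral_inner_convect_laplacian_fourierTruncate_le hmem hdiv hgrad hfin N).trans ?_
  -- the factors
  have h1 : ‖mFourierCoeff (EuclideanSpace.complexify ∘ u τ) 0‖ ≤ Real.sqrt E := norm_mFourierCoeff_zero_le_sqrt hmem
  have h2 : Real.sqrt (2 * (eGradNormSq (u τ)).toReal) ≤ Real.sqrt (2 * B) := by
    refine Real.sqrt_le_sqrt (mul_le_mul_of_nonneg_left ?_ (by norm_num))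
    have := ENNReal.toReal_mono ENNReal.coe_ne_top hB
    simpa using this
  have h3 : Real.sqrt ((tailLaplacianNormSq N (u τ)).toReal) ≤ Real.sqrt P :=
    Real.sqrt_le_sqrt (ENNReal.toReal_mono hfin (tailLaplacianNormSq_le N (u τ)))
  have h4 : Real.sqrt (P / (16 * Real.pi ^ 4)) * Real.sqrt P = P / (4 * Real.pi ^ 2) := by
    rw [← Real.sqrt_mul (div_nonneg hP0 (by positivity)), show P / (16 * Real.pi ^ 4) * P =
      (P / (4 * Real.pi ^ 2)) ^ 2 by field_simp; ring, Real.sqrt_sq (div_nonneg hP0 (by positivity))]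
  have h5 : Real.sqrt E * Real.sqrt P ≤ 2⁻¹ * (E + P) := by
    have := two_mul_le_add_sq (Real.sqrt E) (Real.sqrt P)
    rw [Real.sq_sqrt hE0, Real.sq_sqrt hP0] at this
    linarith
  have hK0 : 0 ≤ ‖mFourierCoeff (EuclideanSpace.complexify ∘ u τ) 0‖ +
      Real.sqrt latticeSumFour * Real.sqrt (P / (16 * Real.pi ^ 4)) := by positivity
  calc (‖mFourierCoeff (EuclideanSpace.complexify ∘ u τ) 0‖ +
          Real.sqrt latticeSumFour * Real.sqrt (P / (16 * Real.pi ^ 4))) *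
        Real.sqrt (2 * (eGradNormSq (u τ)).toReal) * Real.sqrt ((tailLaplacianNormSq N (u τ)).toReal)
      ≤ (Real.sqrt E + Real.sqrt latticeSumFour * Real.sqrt (P / (16 * Real.pi ^ 4))) *
          Real.sqrt (2 * B) * Real.sqrt P := by gcongr
    _ = Real.sqrt (2 * B) * (Real.sqrt E * Real.sqrt P +
          Real.sqrt latticeSumFour * (Real.sqrt (P / (16 * Real.pi ^ 4)) * Real.sqrt P)) := by ring
    _ ≤ Real.sqrt (2 * B) * (2⁻¹ * (E + P) + Real.sqrt latticeSumFour * (P / (4 * Real.pi ^ 2))) := by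
        rw [h4]; gcongr
    _ = _ := by ring

/-- The real palinstrophy `τ ↦ (‖Δu(τ)‖₂²).toReal` is integrable on `(0, T]` when
`∫₀ᵀ ‖Δu‖₂² < ∞`. [folklore] -/
theorem integrableOn_toReal_eLaplacianNormSq {d : Type*} [Fintype d] [DecidableEq d]
    {F : ℝ → UnitAddTorus d → EuclideanSpace ℝ d} {u₀ : UnitAddTorus d → EuclideanSpace ℝ d}
    {u : ℝ → UnitAddTorus d → EuclideanSpace ℝ d} (hu : IsLerayHopfOn T ν F u₀ u)
    (hlap : ∫⁻ τ in Ioo 0 T, eLaplacianNormSq (u τ) < ⊤) :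
    IntegrableOn (fun τ => (eLaplacianNormSq (u τ)).toReal) (Ioc 0 T) := by
  rw [integrableOn_Ioc_iff_integrableOn_Ioo (by finiteness)]
  exact integrable_toReal_of_lintegral_ne_top hu.aemeasurable_eLaplacianNormSq hlap.ne

/-- The palinstrophy of a.e. slice is finite on `(s, t] ⊆ (0, T]` when `∫₀ᵀ‖Δu‖₂² < ∞`. [folklore] -/
theorem ae_eLaplacianNormSq_ne_top {d : Type*} [Fintype d] [DecidableEq d]
    {F : ℝ → UnitAddTorus d → EuclideanSpace ℝ d} {u₀ : UnitAddTorus d → EuclideanSpace ℝ d}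
    {u : ℝ → UnitAddTorus d → EuclideanSpace ℝ d} (hu : IsLerayHopfOn T ν F u₀ u)
    (hlap : ∫⁻ τ in Ioo 0 T, eLaplacianNormSq (u τ) < ⊤) {s t : ℝ} (hs : 0 ≤ s) (htT : t ≤ T) :
    ∀ᵐ τ ∂(volume.restrict (Ioc s t)), eLaplacianNormSq (u τ) ≠ ⊤ := by
  have h1 : ∀ᵐ τ ∂(volume.restrict (Ioo 0 T)), eLaplacianNormSq (u τ) < ⊤ :=
    ae_lt_top' hu.aemeasurable_eLaplacianNormSq hlap.ne
  rw [Measure.restrict_congr_set (Ioo_ae_eq_Ioc (μ := volume) (a := (0 : ℝ)) (b := T))] at h1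
  exact (ae_restrict_of_ae_restrict_of_subset (Ioc_subset_Ioc hs htT) h1).mono fun τ hτ => hτ.ne

/-- **Discharge of `NS.enstrophy_balance_of_regular_torus2`** — the enstrophy balance of
regular Leray–Hopf solutions on `𝕋²` (Foias–Manley–Rosa–Temam 2001, App. II.A (A.65) with
Remark 7.1 and (A.62); Temam 1984, Ch. III Lemma 1.2; Kuksin–Shirikyan 2012, Prop. 2.1.21 (ii)):
the truncated identities `Torus.truncEnstrophy_sub_eq` are sent to `N → ∞` — the enstrophies of
the truncations converge (`tendsto_toReal_eGradNormSq_fourierTruncate`), the palinstrophy and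
force rates by dominated convergence (`tendsto_palinRate`, `tendsto_forceRate`, bounds
`palinRate_le`, `abs_forceRate_le`), and the trilinear rates tend to zero in the mean
(`abs_nonlinRate_le` and `Torus.tendsto_integral_inner_convect_laplacian_fourierTruncate`). [cite: FoiasManleyRosaTemam2001, App. II.A (A.62), (A.65); Remark 7.1] -/
theorem _root_.Literature.Analysis.FluidPDE.enstrophy_balance_of_regular_torus2_holds :
    enstrophy_balance_of_regular_torus2 := by
  intro ν T f u₀ u _hν hT hf _hu₀ _hu₀div hu hB hlap s t hs hst htT
  obtain ⟨B, hB⟩ := hB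
  haveI : IsFiniteMeasure (volume.restrict (Ioc s t)) := isFiniteMeasure_restrict.2 measure_Ioc_lt_top.ne
  have hsub : Ioc s t ⊆ Ioc 0 T := Ioc_subset_Ioc hs.le htT
  have hmemτ : ∀ τ ∈ Ioc s t, τ ∈ Ioc 0 T := fun τ hτ => hsub hτ
  -- integrability of the three rates and of the bounds on `(s, t]`
  have hP : IntegrableOn (fun τ => (eLaplacianNormSq (u τ)).toReal) (Ioc s t) :=
    (Torus.integrableOn_toReal_eLaplacianNormSq hu hlap).mono_set hsub
  have hE : IntegrableOn (fun τ => ∫ x, ‖u τ x‖ ^ 2) (Ioc s t) :=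
    ((integrableOn_Ioc_iff_integrableOn_Ioo (by finiteness)).2 hu.integrableOn_integral_norm_sq).mono_set hsub
  have hae : ∀ᵐ τ ∂(volume.restrict (Ioc s t)), eLaplacianNormSq (u τ) ≠ ⊤ :=
    ae_eLaplacianNormSq_ne_top hu hlap hs.le htT
  have haeI : ∀ᵐ τ ∂(volume.restrict (Ioc s t)), τ ∈ Ioc s t := ae_restrict_mem measurableSet_Ioc
  have hnl : ∀ N, IntegrableOn (nonlinRate u N) (Ioc s t) := fun N => integrableOn_nonlinRate hu hf N hs htT
  have hpr : ∀ N, IntegrableOn (palinRate u N) (Ioc s t) := fun N =>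
    integrableOn_Ioc_of_continuousOn_Ioc (continuousOn_palinRate hu N) hs htT
  have hfr : ∀ N, IntegrableOn (forceRate f u N) (Ioc s t) := fun N =>
    integrableOn_Ioc_of_continuousOn_Ioc (continuousOn_forceRate hu N) hs htT
  -- the identity for every `N`, integrals split
  have hid : ∀ N, truncEnstrophy u N t - truncEnstrophy u N s =
      2 * ((∫ τ in Ioc s t, nonlinRate u N τ) - ν * (∫ τ in Ioc s t, palinRate u N τ) +
        ∫ τ in Ioc s t, forceRate f u N τ) := by
    intro N
    have i2 : Integrable (fun τ => ν * palinRate u N τ) (volume.restrict (Ioc s t)) := (hpr N).const_mul ν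
    have i1 : Integrable (fun τ => nonlinRate u N τ - ν * palinRate u N τ) (volume.restrict (Ioc s t)) :=
      (hnl N).sub i2
    rw [truncEnstrophy_sub_eq hu hT hf hs hst htT N, integral_add i1 (hfr N), integral_sub (hnl N) i2,
      integral_const_mul]
  -- limit of the left side
  have hZ : ∀ {τ : ℝ}, τ ∈ Ioc 0 T → Tendsto (fun N => truncEnstrophy u N τ) atTop
      (𝓝 (eGradNormSq (u τ)).toReal) := by
    intro τ hτ
    have hint : Integrable (u τ) volume := (hu.memLp τ ⟨hτ.1.le, hτ.2⟩).integrable one_le_two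
    have hfin : eGradNormSq (u τ) ≠ ⊤ := ne_top_of_le_ne_top ENNReal.coe_ne_top (hB τ hτ)
    refine (tendsto_toReal_eGradNormSq_fourierTruncate hint hfin).congr fun N => ?_
    rw [truncEnstrophy_eq_toReal hu hτ N]
  have hL : Tendsto (fun N => truncEnstrophy u N t - truncEnstrophy u N s) atTop
      (𝓝 ((eGradNormSq (u t)).toReal - (eGradNormSq (u s)).toReal)) :=
    (hZ ⟨hs.trans_le hst, htT⟩).sub (hZ ⟨hs, hst.trans htT⟩)
  -- the palinstrophy integrals converge (dominated by the palinstrophy)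
  have hPlim : Tendsto (fun N => ∫ τ in Ioc s t, palinRate u N τ) atTop
      (𝓝 (∫ τ in Ioc s t, (eLaplacianNormSq (u τ)).toReal)) := by
    refine tendsto_integral_of_dominated_convergence (fun τ => (eLaplacianNormSq (u τ)).toReal)
      (fun N => (hpr N).aestronglyMeasurable) hP (fun N => ?_) ?_
    · filter_upwards [hae, haeI] with τ hτ hτI
      rw [Real.norm_of_nonneg (palinRate_nonneg u N τ)]
      exact palinRate_le hu (hmemτ τ hτI) hτ N
    · filter_upwards [hae, haeI] with τ hτ hτI
      exact tendsto_palinRate hu (hmemτ τ hτI) hτ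
  -- the force integrals converge
  have hFlim : Tendsto (fun N => ∫ τ in Ioc s t, forceRate f u N τ) atTop
      (𝓝 (∫ τ in Ioc s t, -∫ x, ⟪FunctionSpaces.Torus.laplacian f x, u τ x⟫)) := by
    refine tendsto_integral_of_dominated_convergence
      (fun τ => 2⁻¹ * ((∫ x, ‖u τ x‖ ^ 2) + ∫ x, ‖FunctionSpaces.Torus.laplacian f x‖ ^ 2))
      (fun N => (hfr N).aestronglyMeasurable) ((hE.add (integrable_const _)).const_mul 2⁻¹) (fun N => ?_) ?_
    · filter_upwards [haeI] with τ hτI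
      rw [Real.norm_eq_abs]
      exact abs_forceRate_le hu hf (hmemτ τ hτI) N
    · filter_upwards [haeI] with τ hτI
      exact tendsto_forceRate hu hf (hmemτ τ hτI)
  -- the trilinear integrals tend to zero
  have hNlim : Tendsto (fun N => ∫ τ in Ioc s t, nonlinRate u N τ) atTop (𝓝 (∫ τ in Ioc s t, (0 : ℝ))) := by
    refine tendsto_integral_of_dominated_convergence
      (fun τ => Real.sqrt (2 * B) * (2⁻¹ * ((∫ x, ‖u τ x‖ ^ 2) + (eLaplacianNormSq (u τ)).toReal) +
        Real.sqrt latticeSumFour / (4 * Real.pi ^ 2) * (eLaplacianNormSq (u τ)).toReal))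
      (fun N => (hnl N).aestronglyMeasurable) ((((hE.add hP).const_mul 2⁻¹).add (hP.const_mul _)).const_mul _)
      (fun N => ?_) ?_
    · filter_upwards [hae, haeI] with τ hτ hτI
      rw [Real.norm_eq_abs]
      exact abs_nonlinRate_le hu (hmemτ τ hτI) (hB τ (hmemτ τ hτI)) hτ N
    · filter_upwards [hae, haeI] with τ hτ hτI
      have hτ' := hmemτ τ hτI
      have hmem : MemLp (u τ) 2 volume := hu.memLp τ ⟨hτ'.1.le, hτ'.2⟩
      have hgrad : eGradNormSq (u τ) ≠ ⊤ := ne_top_of_le_ne_top ENNReal.coe_ne_top (hB τ hτ')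
      have h := (tendsto_integral_inner_convect_laplacian_fourierTruncate hmem
        (hu.isWeaklyDivFree_of_mem_Ioc hτ') hgrad hτ).neg
      rw [neg_zero] at h
      refine h.congr fun N => ?_
      rw [nonlinRate_eq hu hτ' N]
  rw [integral_zero] at hNlim
  -- pass to the limit in the identity
  have hR : Tendsto (fun N => 2 * ((∫ τ in Ioc s t, nonlinRate u N τ) - ν * (∫ τ in Ioc s t, palinRate u N τ) +
      ∫ τ in Ioc s t, forceRate f u N τ)) atTop
      (𝓝 (2 * (0 - ν * (∫ τ in Ioc s t, (eLaplacianNormSq (u τ)).toReal) +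
        ∫ τ in Ioc s t, -∫ x, ⟪FunctionSpaces.Torus.laplacian f x, u τ x⟫))) :=
    ((hNlim.sub (hPlim.const_mul ν)).add hFlim).const_mul 2
  have heq := tendsto_nhds_unique hL (hR.congr fun N => (hid N).symm)
  rw [integral_neg] at heq
  linarith
  
end TwoD

end Literature.Analysis.FluidPDE.Torus
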